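import Summits.AnomalousDissipation.AnomalousDissipation.Theses.ImpulseGrid
import Literature.Analysis.FluidPDE.StokesTorus

/-!
# Sketch — crux-ideate stmt-AnomalousDissipation-14349 (ImpulseGrid.GridSignsLaw), ideator 1, round 1

First lemmas of the three idea cards (statements only; they must ELABORATE, proofs are not the
point at this stage):

* `MeanWakeMargin`, `MeanWakeTransfer`      — card `mean-wake-quadrant`
* `ProfileFluxLaw`                          — card `mean-wake-quadrant` (second stub)
* `ImprintBudget`                           — card `imprint-budget`
* `CrossedShearQuietCore`, `SteadyGridSigns` — card `quiet-core-audit`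
-/

namespace Summit.AnomalousDissipation.AnomalousDissipation.Cruxes.GridSignsLaw.SketchIdeator1

open MeasureTheory Filter
open Literature.Analysis.FunctionSpaces Literature.Analysis.FluidPDE
open Summit.AnomalousDissipation.AnomalousDissipation.Theses.ImpulseGrid

local notation "𝕋³" => UnitAddTorus (Fin 3)
local notation "E³" => EuclideanSpace ℝ (Fin 3)

/-- The DESIGN clause list of `GridSignsLaw` (verbatim), packaged as a predicate on `(Φ, Ψ, G, c)`. -/
def IsGridDesign (Φ Ψ : 𝕋³ → ℝ) (G : 𝕋³ → E³) (c : ℝ) : Prop :=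
  Torus.IsSmooth Φ ∧ Torus.IsSmooth Ψ ∧ Torus.IsSmooth G ∧
  (∀ (s : UnitAddCircle) x, Φ (x + Pi.single (1 : Fin 3) s) = Φ x ∧ Φ (x + Pi.single (2 : Fin 3) s) = Φ x) ∧
  (∫ x, Φ x = 1) ∧
  (∀ (s : UnitAddCircle) x, Ψ (x + Pi.single (1 : Fin 3) s) = Ψ x ∧ Ψ (x + Pi.single (2 : Fin 3) s) = Ψ x) ∧
  (∀ (s : UnitAddCircle) x, G (x + Pi.single (0 : Fin 3) s) = G x) ∧ (∀ x, G x 0 = 0) ∧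
  Torus.IsDivFree G ∧ (∀ x, Torus.partialDeriv 0 Ψ x = Φ x - 1) ∧
  (∫ x, Φ x * Ψ x * ‖G x‖ ^ 2 = 0) ∧
  Torus.IsSmooth (fun x => Φ x • G x) ∧ Torus.IsDivFree (fun x => Φ x • G x) ∧
  Torus.HasZeroMean (fun x => Φ x • G x) ∧ 0 < c

/-- The FAMILY hypothesis list of `GridSignsLaw` (verbatim): a vanishing-viscosity global Leray–Hopf
family forced by `Φ•G` with drift data `∫u₀ⱼ = c e₀`, per-`j` sup-energy bounds and `meanEnergy ≤ E`. -/
def IsDriftFamily (Φ : 𝕋³ → ℝ) (G : 𝕋³ → E³) (c : ℝ) (ν : ℕ → ℝ) (u₀ : ℕ → 𝕋³ → E³)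
    (u : ℕ → ℝ → 𝕋³ → E³) (E : ℝ) : Prop :=
  (∀ j, 0 < ν j) ∧ Tendsto ν atTop (nhds 0) ∧
  (∀ j, Torus.IsGlobalLerayHopf (ν j) (fun _ => fun x => Φ x • G x) (u₀ j) (u j)) ∧
  (∀ j, ∃ C : ℝ, ∀ t : ℝ, 0 ≤ t → Torus.kineticEnergy (u j t) ≤ C) ∧
  (∀ j, ∫ x, u₀ j x = c • EuclideanSpace.single 0 1) ∧
  (∀ j, meanEnergy (u j) ≤ E)

/-! ## Card `mean-wake-quadrant` -/

/-- **C⁺ of card mean-wake-quadrant (MeanWakeMargin).** First-moment, Λ-robust, margin form of the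
grid sign law: some design such that for every bounded-energy drift family and EVERY generalized
limit `Λ` there are `κ > 0` and `J` with, for `j ≥ J`,
`κ ≤ Λ⟨(G,u_j)⟩` (imprint floor on circuit average) and `κ ≤ Λ⟨((Φ−1)G,u_j)⟩` (imprint larger at
the slab than on circuit average). Both are LINEAR functionals of the Banach-mean velocity `Ū_j`;
the cubic functional of `GridSignsLaw` (b) and the sawtooth `Ψ` are gone (they re-enter only through
an `O(ν_j)` term handled in `MeanWakeTransfer`). -/
def MeanWakeMargin : Prop :=
  ∃ (Φ Ψ : 𝕋³ → ℝ) (G : 𝕋³ → E³) (c : ℝ), IsGridDesign Φ Ψ G c ∧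
    ∀ (ν : ℕ → ℝ) (u₀ : ℕ → 𝕋³ → E³) (u : ℕ → ℝ → 𝕋³ → E³) (E : ℝ), IsDriftFamily Φ G c ν u₀ u E →
      ∀ Λ : GeneralizedLimit, ∃ κ : ℝ, 0 < κ ∧ ∃ J : ℕ, ∀ j, J ≤ j →
        κ ≤ Λ.longTimeAvg (fun t => ∫ x, inner ℝ (G x) (u j t x)) ∧
        κ ≤ Λ.longTimeAvg (fun t => ∫ x, (Φ x - 1) * inner ℝ (G x) (u j t x))

/-- **First lemma of card mean-wake-quadrant (the transfer stub).** `MeanWakeMargin` implies the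
crux, given the route's provable-now support `GridInjectionIdentity`: (a) is the first floor; for (b)
write, by identity (1) with `∫ΦΨ|G|² = 0`,
`Λ⟨∫⟪w,(w·∇)(ΨG)⟫⟩ = cΛ(G,u) − cΛ(ΦG,u) − νΛ(u,Δ(ΨG)) = −cΛ((Φ−1)G,u) − νΛ(u,Δ(ΨG))`,
bound `|νⱼΛ(uⱼ,Δ(ΨG))| ≤ νⱼ‖Δ(ΨG)‖_∞(1+E)/2 → 0` (honesty of `Λ` + `meanEnergy ≤ E`, as in the
route's Assembly item), take `η := cκ/2` and enlarge `J`; `Λ` from `GeneralizedLimit.nonempty`.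
Size M (linearity of `Λ.longTimeAvg` on the integrable pairings). -/
def MeanWakeTransfer : Prop :=
  MeanWakeMargin → GridInjectionIdentity → GridSignsLaw

/-- **Second stub of card mean-wake-quadrant (ProfileFluxLaw): the streamwise flux law of the
imprint, tested form.** For every smooth weight `ρ` depending on `x₀` only and every global
Leray–Hopf solution with a sup-energy bound (any constant `c`; the `c`-terms are explicit):
`Λ⟨∫ u₀ ∂₀ρ ⟪G,u⟫⟩ + Λ⟨∫ ρ ⟪u,(u·∇)G⟫⟩ + νΛ⟨(u,Δ(ρG))⟩ + ∫Φρ|G|² = 0`,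
i.e. distributionally on the circle `(cJ̃ + S̃)' = Φ‖G‖² + T̃ + O(ν)` for the imprint profile
`J̃`, the transport profile `S̃` and the destruction profile `T̃`. It is `MeanMomentumBalance` at the
admissible test field `ρ•G` plus the pointwise algebra `⟪u,(u·∇)(ρG)⟫ = u₀∂₀ρ⟪G,u⟫ + ρ⟪u,(u·∇)G⟫`
(`G₀ = 0`, `∂₀G = 0`); `ρ ∈ {1, Ψ}` are the two conjuncts of `GridInjectionIdentity`. Provable now. -/
def ProfileFluxLaw : Prop :=
  ∀ (Λ : GeneralizedLimit) (ν : ℝ) (Φ ρ : 𝕋³ → ℝ) (G : 𝕋³ → E³) (u₀ : 𝕋³ → E³) (u : ℝ → 𝕋³ → E³),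
    0 < ν → Torus.IsSmooth Φ → Torus.IsSmooth ρ → Torus.IsSmooth G →
    (∀ (s : UnitAddCircle) x, ρ (x + Pi.single (1 : Fin 3) s) = ρ x ∧ ρ (x + Pi.single (2 : Fin 3) s) = ρ x) →
    (∀ (s : UnitAddCircle) x, G (x + Pi.single (0 : Fin 3) s) = G x) → (∀ x, G x 0 = 0) →
    Torus.IsDivFree G →
    Torus.IsGlobalLerayHopf ν (fun _ => fun x => Φ x • G x) u₀ u →
    (∃ C : ℝ, ∀ t : ℝ, 0 ≤ t → Torus.kineticEnergy (u t) ≤ C) →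
    Λ.longTimeAvg (fun t => ∫ x, (u t x 0) * Torus.partialDeriv 0 ρ x * inner ℝ (G x) (u t x)) +
      Λ.longTimeAvg (fun t => ∫ x, ρ x * inner ℝ (u t x) (Torus.convect (u t) G x)) +
      ν * Λ.longTimeAvg (fun t => ∫ x, inner ℝ (u t x) (Torus.laplacian (fun y => ρ y • G y) x)) +
      ∫ x, Φ x * ρ x * ‖G x‖ ^ 2 = 0

/-! ## Card `imprint-budget` -/

/-- **First lemma of card imprint-budget (ImprintBudget): the first degree-2 (u-dependent test field)
auxiliary-functional identity of the grid wake.** Let `k` be smooth, even, depending on `x₀` only,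
and let `m_u(t,x) := ∫ k(x−y) ⟪G(y),u(t,y)⟫ dy` (the `k`-smoothed imprint profile, a smooth function
of `x₀`). The quadratic functional `V(u) = ½∫∫ k(x−y)⟪G(x),u(x)⟫⟪G(y),u(y)⟫` ("coherent imprint
energy") is bounded along a sup-energy Leray–Hopf trajectory and `dV/dt = (∂ₜu, m_u•G)` with the
ADMISSIBLE (smooth, divergence-free) test field `m_u•G`, so its Banach mean vanishes:
`Λ⟨∫⟪u,(u·∇)(m_u G)⟫⟩ + νΛ⟨(u,Δ(m_u G))⟩ + Λ⟨∫Φ m_u |G|²⟩ = 0`.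
Expanded (`⟪u,(u·∇)(m_uG)⟫ = u₀∂₀m_u⟪G,u⟫ + m_u⟪u,(u·∇)G⟫`, and the drift part
`c∫∫k'(x₀−y₀)… = 0` by oddness of `k'`): ‖G‖²·Λ⟨(Φ, k∗J)⟩ = −Λ⟨(k∗J, T)⟩ − Λ⟨(w₀∂₀(k∗J), J)⟩ + O(ν)
— "Φ-smoothed INJECTION = minus the imprint–destruction correlation minus transport". As `k → δ`
this is `‖G‖²·injection = −Λ⟨∫ J(x₀,t) T(x₀,t) dx₀⟩ − Λ⟨∫ S ∂₀J⟩`. Provable now (same toolkit as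
`MeanMomentumBalance`, with a time-dependent smooth test field built from `u` itself). -/
def ImprintBudget : Prop :=
  ∀ (Λ : GeneralizedLimit) (ν : ℝ) (Φ k : 𝕋³ → ℝ) (G : 𝕋³ → E³) (u₀ : 𝕋³ → E³) (u : ℝ → 𝕋³ → E³),
    0 < ν → Torus.IsSmooth Φ → Torus.IsSmooth k → Torus.IsSmooth G →
    (∀ (s : UnitAddCircle) x, k (x + Pi.single (1 : Fin 3) s) = k x ∧ k (x + Pi.single (2 : Fin 3) s) = k x) →
    (∀ x, k (-x) = k x) →
    (∀ (s : UnitAddCircle) x, G (x + Pi.single (0 : Fin 3) s) = G x) → (∀ x, G x 0 = 0) →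
    Torus.IsDivFree G →
    Torus.IsGlobalLerayHopf ν (fun _ => fun x => Φ x • G x) u₀ u →
    (∃ C : ℝ, ∀ t : ℝ, 0 ≤ t → Torus.kineticEnergy (u t) ≤ C) →
    let m : ℝ → 𝕋³ → ℝ := fun t x => ∫ y, k (x - y) * inner ℝ (G y) (u t y)
    Λ.longTimeAvg (fun t => ∫ x, inner ℝ (u t x) (Torus.convect (u t) (fun y => m t y • G y) x)) +
      ν * Λ.longTimeAvg (fun t => ∫ x, inner ℝ (u t x) (Torus.laplacian (fun y => m t y • G y) x)) +
      Λ.longTimeAvg (fun t => ∫ x, Φ x * m t x * ‖G x‖ ^ 2) = 0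

/-- **C⁺ of card imprint-budget (ImprintCertificate)**: a Λ-FREE pointwise certificate. Some design,
and for every energy level `E` a margin `κ > 0`, a viscosity threshold `ν₀ > 0` and, for each
`ν < ν₀`, two smooth `x₀`-kernels `k_a, k_b` (degree-2 multipliers) and two smooth divergence-free
steady test fields `χ_a, χ_b` (degree-1 multipliers) such that the two POINTWISE-IN-PHASE-SPACE
inequalities below hold at every smooth divergence-free field `v` with `∫v = c e₀` and
`∫|v|² ≤ 2E + 1`: the (a)-functional `(G,v)` minus `κ`, resp. minus the (b)-functional
`c((Φ−1)G,v)` minus `κ`, dominates the formal time-derivative of the auxiliary functional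
`V = ½∫∫k⟪G,·⟫⟪G,·⟫ + (·,χ)` along NS_ν (`= ∫⟪v,(v·∇)W⟫ + ν(v,ΔW) + (Φ G, W)` at the `v`-dependent
test field `W = m_v•G + χ`). Time-averaging the inequality along any sup-energy Leray–Hopf
trajectory with `meanEnergy ≤ E` kills the derivative term (ImprintBudget + MeanMomentumBalance) and
leaves the two floors of `MeanWakeMargin` for liminf AND limsup of Cesàro means — hence for every
honest `Λ`. (Approximation of LH states by smooth fields in the energy ball is part of the transfer
stub, not of this statement.) -/
def ImprintCertificate : Prop :=
  ∃ (Φ Ψ : 𝕋³ → ℝ) (G : 𝕋³ → E³) (c : ℝ), IsGridDesign Φ Ψ G c ∧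
    ∀ E : ℝ, ∃ κ : ℝ, 0 < κ ∧ ∃ ν₀ : ℝ, 0 < ν₀ ∧ ∀ ν : ℝ, 0 < ν → ν < ν₀ →
      ∃ (ka kb : 𝕋³ → ℝ) (χa χb : 𝕋³ → E³),
        Torus.IsSmooth ka ∧ Torus.IsSmooth kb ∧ Torus.IsSmooth χa ∧ Torus.IsSmooth χb ∧
        Torus.IsDivFree χa ∧ Torus.IsDivFree χb ∧
        (∀ (s : UnitAddCircle) x, ka (x + Pi.single (1 : Fin 3) s) = ka x ∧ ka (x + Pi.single (2 : Fin 3) s) = ka x ∧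
          kb (x + Pi.single (1 : Fin 3) s) = kb x ∧ kb (x + Pi.single (2 : Fin 3) s) = kb x) ∧
        (∀ x, ka (-x) = ka x ∧ kb (-x) = kb x) ∧
        ∀ v : 𝕋³ → E³, Torus.IsSmooth v → Torus.IsDivFree v →
          (∫ x, v x = c • EuclideanSpace.single 0 1) → (∫ x, ‖v x‖ ^ 2 ≤ 2 * E + 1) →
          let Wa : 𝕋³ → E³ := fun x => (∫ y, ka (x - y) * inner ℝ (G y) (v y)) • G x + χa x
          let Wb : 𝕋³ → E³ := fun x => (∫ y, kb (x - y) * inner ℝ (G y) (v y)) • G x + χb x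
          (κ ≤ (∫ x, inner ℝ (G x) (v x)) +
              ((∫ x, inner ℝ (v x) (Torus.convect v Wa x)) + ν * (∫ x, inner ℝ (v x) (Torus.laplacian Wa x)) +
                ∫ x, inner ℝ (Φ x • G x) (Wa x))) ∧
          (κ ≤ c * (∫ x, (Φ x - 1) * inner ℝ (G x) (v x)) +
              ((∫ x, inner ℝ (v x) (Torus.convect v Wb x)) + ν * (∫ x, inner ℝ (v x) (Torus.laplacian Wb x)) +
                ∫ x, inner ℝ (Φ x • G x) (Wb x)))

/-! ## Card `quiet-core-audit` -/

/-- **First lemma of card quiet-core-audit (CrossedShearQuietCore)**: the exact zero-work steady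
Euler core of a RECTANGULAR cellular pattern. For amplitudes `A B`, transverse wavenumbers
`mx, ny : ℤ` and any drift `c`, the crossed Kolmogorov shears
`u* = c e₀ + A sin(2π ny x₂) e₁ + B sin(2π mx x₁) e₂` (written with the tree's real Stokes
eigenfields `Torus.stokesMode k a false = sin(2π k·x) a`) satisfy `(u*·∇)u* = G_cell + ∇q` with the
explicit smooth pressure `q` and the divergence-free transverse pattern `G_cell`, `G_cell ⊥ e₀`,
`∂₀G_cell = 0`, whose curl is `4π²(ny² − mx²)·A·B·sin(2π mx x₁) sin(2π ny x₂)` — a Taylor–Green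
array of RECTANGULAR cells when `mx² ≠ ny²` — and the work vanishes: `∫⟪G_cell,u*⟫ = 0`. Hence for
designs whose `x₀`-mean pattern `G` is such a `G_cell`, the mean force is balanced by a bounded
steady state doing no work (a quiet core); for SQUARE cells (`mx² = ny²`) the cellular part
vanishes identically. Pure algebra; provable now (size S/M: Stokes-mode calculus in the tree). -/
def CrossedShearQuietCore : Prop :=
  ∀ (A B c : ℝ) (mx ny : ℤ),
    let e₀ : E³ := EuclideanSpace.single 0 1
    let e₁ : E³ := EuclideanSpace.single 1 1
    let e₂ : E³ := EuclideanSpace.single 2 1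
    let U : 𝕋³ → E³ := fun x => (Torus.stokesMode (Pi.single 2 ny) (A • e₁) false) x
    let V : 𝕋³ → E³ := fun x => (Torus.stokesMode (Pi.single 1 mx) (B • e₂) false) x
    let ustar : 𝕋³ → E³ := fun x => c • e₀ + U x + V x
    ∃ (q : 𝕋³ → ℝ) (Gcell : 𝕋³ → E³), Torus.IsSmooth q ∧ Torus.IsSmooth Gcell ∧ Torus.IsDivFree Gcell ∧
      (∀ x, Gcell x 0 = 0) ∧ (∀ (s : UnitAddCircle) x, Gcell (x + Pi.single (0 : Fin 3) s) = Gcell x) ∧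
      (∀ x, Torus.convect ustar ustar x = Gcell x + Torus.gradient q x) ∧
      (∫ x, inner ℝ (Gcell x) (ustar x) = 0) ∧
      (∀ x, Torus.partialDeriv 1 (fun y => Gcell y 2) x - Torus.partialDeriv 2 (fun y => Gcell y 1) x =
        4 * Real.pi ^ 2 * ((ny : ℝ) ^ 2 - (mx : ℝ) ^ 2) * A * B *
          ((Torus.stokesMode (Pi.single 1 mx) e₁ false) x 1) * ((Torus.stokesMode (Pi.single 2 ny) e₁ false) x 1))

/-- **Second statement of card quiet-core-audit (SteadyGridSigns): the crux on the steady branches —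
the necessary special case to decide first.** Some design (the same clause list) such that every
family of smooth STEADY Navier–Stokes states `u_j` (viscosities `ν_j → 0`, force `Φ•G`, momentum
`∫u_j = c e₀`, `∫|u_j|² ≤ E`) eventually satisfies the two signs with a margin:
`0 ≤ ∫⟪G,u_j⟫` and `∫⟪u_j − c e₀, ((u_j − c e₀)·∇)(ΨG)⟫ ≤ −η`. Steady states are global
Leray–Hopf solutions from themselves with constant Cesàro means, so `GridSignsLaw ⇒ SteadyGridSigns`
for the same design; a bounded QUIET steady branch (`ν_j‖∇u_j‖² → 0`) violates it (then
`c∫(Φ−1)⟪G,u_j⟫ → 0` by the steady energy identity and identity (1)), so for the chosen design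
this item says: every bounded steady branch is LOUD and correctly signed. -/
def SteadyGridSigns : Prop :=
  ∃ (Φ Ψ : 𝕋³ → ℝ) (G : 𝕋³ → E³) (c : ℝ), IsGridDesign Φ Ψ G c ∧
    ∀ (ν : ℕ → ℝ) (u : ℕ → 𝕋³ → E³) (p : ℕ → 𝕋³ → ℝ) (E : ℝ),
      (∀ j, 0 < ν j) → Tendsto ν atTop (nhds 0) →
      (∀ j, Torus.IsClassicalNSSolutionOn Set.univ (ν j) (fun _ => fun x => Φ x • G x) (fun _ => u j) (fun _ => p j)) →
      (∀ j, ∫ x, u j x = c • EuclideanSpace.single 0 1) → (∀ j, ∫ x, ‖u j x‖ ^ 2 ≤ E) →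
      ∃ η : ℝ, 0 < η ∧ ∃ J : ℕ, ∀ j, J ≤ j →
        0 ≤ ∫ x, inner ℝ (G x) (u j x) ∧
        (∫ x, inner ℝ (u j x - c • EuclideanSpace.single 0 1)
            (Torus.convect (fun y => u j y - c • EuclideanSpace.single 0 1) (fun y => Ψ y • G y) x)) ≤ -η

/-- Sanity glue (kernel-checked): the crux restricted to steady branches really is a consequence of
the packaging — `SteadyGridSigns` is stated over the same design predicate as `MeanWakeMargin`. -/
example : MeanWakeTransfer = (MeanWakeMargin → GridInjectionIdentity → GridSignsLaw) := rfl

end Summit.AnomalousDissipation.AnomalousDissipation.Cruxes.GridSignsLaw.SketchIdeator1
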